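import Summits.Ventures.PercRepro.S1CoreCapSixCost
import Summits.Ventures.PercRepro.S1CoreCapSixOne
import Mathlib.Tactic.Ring

/-!
# PercRepro — TOWARDS `Q*(7) = 19`: THE CAP OF A THIN FAMILY UNDER A BUDGET (p1, gen 26)

The common tool of the cases with at most one big line at nullity `7`. A THIN FAMILY over `P₀` is a finset `T` of
3-point lines, each meeting `P₀` in at most one point, pairwise sharing at most one point, with the BUDGET `b` on
free lines and NEW fat points: `freeCountR P₀ l + fat (unionLR P₀ l ∖ P₀) ≤ b` for every duplicate-free list `l`
of lines of `T` (the spec's cost clause after a prefix, `budget_of_prefix`, with the fat points of `P₀` moved to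
the right). THE FAT COUNTING LEMMA (`two_mul_sum_newFat_le`): `2 · Σ_{L ∈ T} (1 + fat (L ∖ P₀)) ≤ b (b + 1)` — the
counting lemma of `S1CoreCapFreeSeq` with the new fat points charged to the lines. Induction on `b` through a point
`v ∉ P₀` of a line of `T`: the lines through `v` form a free sequence whose union carries their new fat points, each
new fat point of the star lying on one star line only except `v` itself (`sum_fat_sdiff_star_le`), so the star
contributes `≤ b + (d − 1)·[v fat]` with `d ≤ b − [v fat]` lines; the lines avoiding `v` have budget `b − 1 − [v fat]`
(prepend a line through `v`: free, and `v` is a new fat point when fat). Then `sum_fat_inter_le`: the fat points OF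
`P₀` lie on at most `b` lines of `T` each (a free sequence through a point of `P₀`, `card_filter_le_of_freeCountR_le'`),
and THE CAP OF A THIN FAMILY (`two_mul_sum_cap_thin_le`): `2 · Σ_{L ∈ T} cap L ≤ b (b + 1) + 2 · fat P₀ · b`, i.e.
`Σ cap ≤ b (b + 1) / 2 + fat P₀ · b`. Instances: one simple 4-point line `A` leaves `b = 5` (`≤ 15`, so cap `≤ 19`),
a simple 5-point line `b = 4` (`≤ 10`), a 4-point line with a fat point `b = 4`, `fat P₀ = 1` (`≤ 14`);
`S1CoreCapSevenOne` assembles the case of one big line from them. `proofs/P1-S4-CAPBRIDGE.md` §18.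
Axioms: standard.
-/

namespace PercRepro

namespace S1

namespace FourCap

namespace Seven

variable {β : Type} [DecidableEq β]

/-! ### Fat points of unions, differences, stars -/

/-- The fat points of a set split along a subset: `fat (U ∖ P₀) + fat P₀ = fat U` when `P₀ ⊆ U`. -/
theorem fat_sdiff_add_fat_of_subset (w : β → ℕ) {P₀ U : Finset β} (h : P₀ ⊆ U) :
    fat w (U \ P₀) + fat w P₀ = fat w U := by
  unfold fat
  have e : (U \ P₀).filter (fun v => w v = 2) = U.filter (fun v => w v = 2) \ P₀.filter (fun v => w v = 2) := by
    ext v; simp only [Finset.mem_filter, Finset.mem_sdiff]; tauto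
  rw [e]
  exact Finset.card_sdiff_add_card_eq_card (Finset.filter_subset_filter _ h)

/-- The fat points of a line split along `P₀`: `fat L = fat (L ∖ P₀) + fat (L ∩ P₀)`. -/
theorem fat_eq_fat_sdiff_add_fat_inter (w : β → ℕ) (L P₀ : Finset β) :
    fat w L = fat w (L \ P₀) + fat w (L ∩ P₀) := by
  unfold fat
  rw [← Finset.card_sdiff_add_card_inter (L.filter (fun v => w v = 2)) P₀]
  have e1 : L.filter (fun v => w v = 2) \ P₀ = (L \ P₀).filter (fun v => w v = 2) := by
    ext v; simp only [Finset.mem_filter, Finset.mem_sdiff]; tauto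
  have e2 : L.filter (fun v => w v = 2) ∩ P₀ = (L ∩ P₀).filter (fun v => w v = 2) := by
    ext v; simp only [Finset.mem_filter, Finset.mem_inter]; tauto
  rw [e1, e2]

/-- Removing a point from a set lowers `fat` by one exactly when the point is fat. -/
theorem fat_erase_add (w : β → ℕ) {S : Finset β} {v : β} (hv : v ∈ S) :
    fat w (S.erase v) + (if w v = 2 then 1 else 0) = fat w S := by
  unfold fat
  rw [Finset.filter_erase]
  split_ifs with h
  · exact Finset.card_erase_add_one (Finset.mem_filter.2 ⟨hv, h⟩)
  · rw [Finset.erase_eq_of_notMem (s := S.filter (fun u => w u = 2)) (a := v)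
      (fun hm => h (Finset.mem_filter.1 hm).2)]
    rfl

/-- Inserting a new point raises `fat` by one exactly when the point is fat. -/
theorem fat_insert_of_notMem (w : β → ℕ) {S : Finset β} {v : β} (hv : v ∉ S) :
    fat w (insert v S) = fat w S + (if w v = 2 then 1 else 0) := by
  have h := fat_erase_add w (S := insert v S) (v := v) (Finset.mem_insert_self v S)
  rw [Finset.erase_insert hv] at h
  omega

/-- **The new fat points of a star**: for a finset `A` of 3-point lines through `v ∉ P₀`, pairwise sharing only `v`,
`Σ_{L ∈ A} fat (L ∖ P₀) + [v fat] ≤ fat (∪A ∖ P₀) + #A · [v fat]` — every new fat point other than `v` lies on one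
line of the star only. -/
theorem sum_fat_sdiff_star_le (w : β → ℕ) (P₀ : Finset β) {v : β} (hvP : v ∉ P₀) (A : Finset (Finset β))
    (hne : A.Nonempty) (hv : ∀ L ∈ A, v ∈ L) (hpair : ∀ L ∈ A, ∀ L' ∈ A, L ≠ L' → (L ∩ L').card ≤ 1) :
    ∑ L ∈ A, fat w (L \ P₀) + (if w v = 2 then 1 else 0) ≤
      fat w ((A.biUnion id) \ P₀) + A.card * (if w v = 2 then 1 else 0) := by
  set e := (if w v = 2 then 1 else 0) with he
  -- each line: `fat (L ∖ P₀) = fat ((L ∖ P₀).erase v) + e`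
  have hline : ∀ L ∈ A, fat w (L \ P₀) = fat w ((L \ P₀).erase v) + e := fun L hL =>
    (fat_erase_add w (Finset.mem_sdiff.2 ⟨hv L hL, hvP⟩)).symm
  rw [Finset.sum_congr rfl hline, Finset.sum_add_distrib, Finset.sum_const_nat (m := e) (fun _ _ => rfl)]
  -- the erased parts are pairwise disjoint
  have hdisj : ∀ L ∈ A, ∀ L' ∈ A, L ≠ L' →
      Disjoint (((L \ P₀).erase v).filter (fun u => w u = 2)) (((L' \ P₀).erase v).filter (fun u => w u = 2)) := by
    intro L hL L' hL' hne
    rw [Finset.disjoint_left]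
    intro u hu hu'
    have h1 := Finset.mem_erase.1 (Finset.mem_filter.1 hu).1
    have h2 := Finset.mem_erase.1 (Finset.mem_filter.1 hu').1
    have hint := hpair L hL L' hL' hne
    exact h1.1 (Finset.card_le_one.1 hint u (Finset.mem_inter.2 ⟨(Finset.mem_sdiff.1 h1.2).1,
      (Finset.mem_sdiff.1 h2.2).1⟩) v (Finset.mem_inter.2 ⟨hv L hL, hv L' hL'⟩))
  have hsum : ∑ L ∈ A, fat w ((L \ P₀).erase v) =
      (A.biUnion (fun L => ((L \ P₀).erase v).filter (fun u => w u = 2))).card := by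
    unfold fat
    rw [Finset.card_biUnion hdisj]
  -- the union of the erased parts lies in the new fat points of the star minus `v`
  have hsub : A.biUnion (fun L => ((L \ P₀).erase v).filter (fun u => w u = 2)) ⊆
      (((A.biUnion id) \ P₀).filter (fun u => w u = 2)).erase v := by
    intro u hu
    obtain ⟨L, hL, hu⟩ := Finset.mem_biUnion.1 hu
    have h1 := Finset.mem_filter.1 hu
    have h2 := Finset.mem_erase.1 h1.1
    have h3 := Finset.mem_sdiff.1 h2.2
    exact Finset.mem_erase.2 ⟨h2.1, Finset.mem_filter.2 ⟨Finset.mem_sdiff.2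
      ⟨Finset.mem_biUnion.2 ⟨L, hL, h3.1⟩, h3.2⟩, h1.2⟩⟩
  have hcard := Finset.card_le_card hsub
  rw [hsum]
  -- `fat (∪A ∖ P₀)` versus the erased version
  obtain ⟨L₀, hL₀⟩ := hne
  have hvU : v ∈ (A.biUnion id) \ P₀ :=
    Finset.mem_sdiff.2 ⟨Finset.mem_biUnion.2 ⟨L₀, hL₀, hv L₀ hL₀⟩, hvP⟩
  have h := fat_erase_add w hvU
  unfold fat at h
  rw [Finset.filter_erase] at h
  rw [← he] at h
  unfold fat
  omega

/-! ### The fat counting lemma -/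

/-- **The fat counting lemma**: a thin family over `P₀` with budget `b` on free lines and new fat points has
`2 · Σ_{L ∈ T} (1 + fat (L ∖ P₀)) ≤ b (b + 1)`. -/
theorem two_mul_sum_newFat_le (w : β → ℕ) (P₀ : Finset β) :
    ∀ (n b : ℕ), b ≤ n → ∀ T : Finset (Finset β), (∀ L ∈ T, L.card = 3 ∧ (L ∩ P₀).card ≤ 1) →
      (∀ L ∈ T, ∀ L' ∈ T, L ≠ L' → (L ∩ L').card ≤ 1) →
      (∀ l : List (Finset β), l.Nodup → (∀ L ∈ l, L ∈ T) →
        freeCountR P₀ l + fat w (unionLR P₀ l \ P₀) ≤ b) →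
      2 * ∑ L ∈ T, (1 + fat w (L \ P₀)) ≤ b * (b + 1)
  | 0, b, hb, T, hT, _, hk => by
    have hb0 : b = 0 := by omega
    subst hb0
    rcases Finset.eq_empty_or_nonempty T with hempty | ⟨L, hL⟩
    · subst hempty; simp
    · exfalso
      have h := hk [L] (List.nodup_singleton L) (by simpa using hL)
      obtain ⟨hL3, hLP⟩ := hT L hL
      have hsd : 0 < (L \ P₀).card := by
        have := Finset.card_sdiff_add_card_inter L P₀
        omega
      obtain ⟨x, hx⟩ := Finset.card_pos.1 hsd
      rw [freeCountR_cons_of_new (Finset.mem_sdiff.1 hx).1 (Finset.mem_sdiff.1 hx).2 (by simp)] at h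
      simp [freeCountR] at h
  | n + 1, b, hb, T, hT, hpair, hk => by
    by_cases hbn : b ≤ n
    · exact two_mul_sum_newFat_le w P₀ n b hbn T hT hpair hk
    have hbe : b = n + 1 := by omega
    rcases Finset.eq_empty_or_nonempty T with hempty | ⟨L₀, hL₀⟩
    · subst hempty; simp
    obtain ⟨hL3, hLP⟩ := hT L₀ hL₀
    have hsd : 0 < (L₀ \ P₀).card := by
      have := Finset.card_sdiff_add_card_inter L₀ P₀
      omega
    obtain ⟨v, hv⟩ := Finset.card_pos.1 hsd
    have hvL : v ∈ L₀ := (Finset.mem_sdiff.1 hv).1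
    have hvP : v ∉ P₀ := (Finset.mem_sdiff.1 hv).2
    set e := (if w v = 2 then 1 else 0) with he
    have he1 : e ≤ 1 := by rw [he]; split_ifs <;> omega
    -- the star of `v`
    set A := T.filter (fun L => v ∈ L) with hA
    have hAmem : ∀ L ∈ A, L ∈ T ∧ v ∈ L := fun L hL => Finset.mem_filter.1 hL
    have hL₀A : L₀ ∈ A := Finset.mem_filter.2 ⟨hL₀, hvL⟩
    have hApair : ∀ L ∈ A, ∀ L' ∈ A, L ≠ L' → (L ∩ L').card ≤ 1 :=
      fun L hL L' hL' hne => hpair L (hAmem L hL).1 L' (hAmem L' hL').1 hne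
    -- the star list is a free sequence whose union carries its new fat points
    have hstar := hk A.toList (Finset.nodup_toList A) (fun L hL => (hAmem L (Finset.mem_toList.1 hL)).1)
    rw [freeCountR_eq_length_of_mem P₀ hvP A.toList (Finset.nodup_toList A)
      (fun L hL => ⟨(hT L (hAmem L (Finset.mem_toList.1 hL)).1).1, (hAmem L (Finset.mem_toList.1 hL)).2,
        (hT L (hAmem L (Finset.mem_toList.1 hL)).1).2⟩)
      (fun L hL L' hL' hne => hApair L (Finset.mem_toList.1 hL) L' (Finset.mem_toList.1 hL') hne),
      Finset.length_toList] at hstar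
    have hUnion : unionLR P₀ A.toList \ P₀ = (A.biUnion id) \ P₀ := by
      ext u
      simp only [Finset.mem_sdiff, mem_unionLR_iff, Finset.mem_biUnion, Finset.mem_toList, id_eq]
      tauto
    rw [hUnion] at hstar
    have hstarfat := sum_fat_sdiff_star_le w P₀ hvP A ⟨L₀, hL₀A⟩ (fun L hL => (hAmem L hL).2) hApair
    have hA1 : 1 ≤ A.card := Finset.card_pos.2 ⟨L₀, hL₀A⟩
    rw [← he] at hstarfat
    -- a fat `v` is a new fat point of the star
    have hvfat : e ≤ fat w ((A.biUnion id) \ P₀) := by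
      rw [he]
      split_ifs with h2
      · exact one_le_fat (Finset.mem_sdiff.2 ⟨Finset.mem_biUnion.2 ⟨L₀, hL₀A, hvL⟩, hvP⟩) h2
      · exact Nat.zero_le _
    -- the lines avoiding `v`: budget `b − 1 − e`
    set B := T.filter (fun L => ¬ v ∈ L) with hB
    have hBk : ∀ l : List (Finset β), l.Nodup → (∀ L ∈ l, L ∈ B) →
        freeCountR P₀ l + fat w (unionLR P₀ l \ P₀) + 1 + e ≤ b := by
      intro l hnd hl
      have hvl : ∀ L ∈ l, v ∉ L := fun L hL => (Finset.mem_filter.1 (hl L hL)).2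
      have hnot : L₀ ∉ l := fun h => hvl L₀ h hvL
      have h := hk (L₀ :: l) (List.nodup_cons.2 ⟨hnot, hnd⟩)
        (fun L hL => by
          rcases List.mem_cons.1 hL with rfl | hL
          · exact hL₀
          · exact (Finset.mem_filter.1 (hl L hL)).1)
      rw [freeCountR_cons_of_new hvL hvP hvl] at h
      have hvU : v ∉ unionLR P₀ l \ P₀ := fun hm => by
        rcases mem_unionLR_iff.1 (Finset.mem_sdiff.1 hm).1 with h' | ⟨L, hL, hvL'⟩
        · exact hvP h'
        · exact hvl L hL hvL'
      have hsub : insert v (unionLR P₀ l \ P₀) ⊆ unionLR P₀ (L₀ :: l) \ P₀ := by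
        intro u hu
        rcases Finset.mem_insert.1 hu with rfl | hu
        · exact Finset.mem_sdiff.2 ⟨mem_unionLR_of_mem List.mem_cons_self hvL, hvP⟩
        · have hu' := Finset.mem_sdiff.1 hu
          refine Finset.mem_sdiff.2 ⟨?_, hu'.2⟩
          simp only [unionLR]
          exact Finset.mem_union_right _ hu'.1
      have hmono : fat w (insert v (unionLR P₀ l \ P₀)) ≤ fat w (unionLR P₀ (L₀ :: l) \ P₀) := by
        unfold fat
        exact Finset.card_le_card (Finset.filter_subset_filter _ hsub)
      rw [fat_insert_of_notMem w hvU, ← he] at hmono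
      omega
    have ih := two_mul_sum_newFat_le w P₀ n (b - 1 - e) (by omega) B
      (fun L hL => hT L (Finset.mem_filter.1 hL).1)
      (fun L hL L' hL' hne => hpair L (Finset.mem_filter.1 hL).1 L' (Finset.mem_filter.1 hL').1 hne)
      (fun l hnd hl => by have := hBk l hnd hl; omega)
    -- the split of the sum
    have hsplit := Finset.sum_filter_add_sum_filter_not T (fun L => v ∈ L) (fun L => 1 + fat w (L \ P₀))
    rw [← hA, ← hB] at hsplit
    rw [← hsplit, Finset.sum_add_distrib, Finset.sum_const_nat (m := 1) (fun _ _ => rfl), Nat.mul_one]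
    -- arithmetic
    have hd : A.card + e ≤ b := by omega
    clear hk hBk hsplit hUnion hAmem hApair
    rcases (by omega : e = 0 ∨ e = 1) with he0 | he1'
    · rw [he0] at hd hstarfat ih
      obtain ⟨m, rfl⟩ : ∃ m, b = m + 1 := ⟨n, hbe⟩
      have key : (m + 1) * (m + 1 + 1) = (m + 1 - 1 - 0) * (m + 1 - 1 - 0 + 1) + 2 * (m + 1) := by
        simp only [Nat.add_sub_cancel, Nat.sub_zero]; ring
      omega
    · rw [he1'] at hd hstarfat ih hvfat
      have hb2 : 2 ≤ b := by omega
      obtain ⟨m, rfl⟩ : ∃ m, b = m + 1 + 1 := ⟨b - 2, by omega⟩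
      have key : (m + 1 + 1) * (m + 1 + 1 + 1) = (m + 1 + 1 - 1 - 1) * (m + 1 + 1 - 1 - 1 + 1) + 4 * m + 6 := by
        simp only [Nat.add_sub_cancel]; ring
      omega

/-! ### The fat points of `P₀` and the cap of a thin family -/

/-- A fat point of `P₀` lies on at most `b` lines of a thin family with free budget `b`. -/
theorem deg_mem_P₀_le (w : β → ℕ) (P₀ : Finset β) (T : Finset (Finset β)) {b : ℕ} (p : β)
    (hT : ∀ L ∈ T, L.card = 3 ∧ (L ∩ P₀).card ≤ 1)
    (hpair : ∀ L ∈ T, ∀ L' ∈ T, L ≠ L' → (L ∩ L').card ≤ 1)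
    (hk : ∀ l : List (Finset β), l.Nodup → (∀ L ∈ l, L ∈ T) →
      freeCountR P₀ l + fat w (unionLR P₀ l \ P₀) ≤ b) :
    (T.filter (fun L => p ∈ L)).card ≤ b :=
  card_filter_le_of_freeCountR_le' P₀ T p hT hpair (fun l hnd hl => by have := hk l hnd hl; omega)

/-- **The fat points of `P₀` on the lines of a thin family**: `Σ_{L ∈ T} fat (L ∩ P₀) ≤ fat P₀ · b`. -/
theorem sum_fat_inter_le (w : β → ℕ) (P₀ : Finset β) (T : Finset (Finset β)) {b : ℕ}
    (hT : ∀ L ∈ T, L.card = 3 ∧ (L ∩ P₀).card ≤ 1)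
    (hpair : ∀ L ∈ T, ∀ L' ∈ T, L ≠ L' → (L ∩ L').card ≤ 1)
    (hk : ∀ l : List (Finset β), l.Nodup → (∀ L ∈ l, L ∈ T) →
      freeCountR P₀ l + fat w (unionLR P₀ l \ P₀) ≤ b) :
    ∑ L ∈ T, fat w (L ∩ P₀) ≤ fat w P₀ * b := by
  have hline : ∀ L ∈ T, fat w (L ∩ P₀) = ∑ p ∈ P₀.filter (fun u => w u = 2), if p ∈ L then 1 else 0 := by
    intro L _
    unfold fat
    have e : (L ∩ P₀).filter (fun u => w u = 2) = (P₀.filter (fun u => w u = 2)).filter (fun p => p ∈ L) := by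
      ext u
      simp only [Finset.mem_filter, Finset.mem_inter]
      tauto
    rw [e, Finset.card_filter]
  rw [Finset.sum_congr rfl hline, Finset.sum_comm]
  have hdeg : ∀ p ∈ P₀.filter (fun u => w u = 2), (∑ L ∈ T, if p ∈ L then 1 else 0) ≤ b := by
    intro p _
    rw [← Finset.card_filter]
    exact deg_mem_P₀_le w P₀ T p hT hpair hk
  refine (Finset.sum_le_sum hdeg).trans ?_
  rw [Finset.sum_const_nat (m := b) (fun _ _ => rfl)]
  rfl

/-- **The cap of a thin family** (lines of weight `≤ 5`): `2 · Σ_{L ∈ T} cap L ≤ b (b + 1) + 2 · fat P₀ · b`. -/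
theorem two_mul_sum_cap_thin_le (w : β → ℕ) (P₀ : Finset β) (T : Finset (Finset β)) {b : ℕ}
    (hT : ∀ L ∈ T, L.card = 3 ∧ (L ∩ P₀).card ≤ 1)
    (hpair : ∀ L ∈ T, ∀ L' ∈ T, L ≠ L' → (L ∩ L').card ≤ 1)
    (hw : ∀ L ∈ T, ∀ v ∈ L, w v = 1 ∨ w v = 2) (hw5 : ∀ L ∈ T, wsum w L ≤ 5)
    (hk : ∀ l : List (Finset β), l.Nodup → (∀ L ∈ l, L ∈ T) →
      freeCountR P₀ l + fat w (unionLR P₀ l \ P₀) ≤ b) :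
    2 * ∑ L ∈ T, capPaper L.card (fat w L) ≤ b * (b + 1) + 2 * (fat w P₀ * b) := by
  have hcap : ∀ L ∈ T, capPaper L.card (fat w L) = (1 + fat w (L \ P₀)) + fat w (L ∩ P₀) := by
    intro L hL
    have h1 := wsum_eq_card_add_fat w L (hw L hL)
    have h2 := hw5 L hL
    have h3 := (hT L hL).1
    rw [h3, capPaper_three_eq' (by omega), fat_eq_fat_sdiff_add_fat_inter w L P₀]
    ring
  rw [Finset.sum_congr rfl hcap, Finset.sum_add_distrib]
  have h1 := two_mul_sum_newFat_le w P₀ b b le_rfl T hT hpair hk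
  have h2 := sum_fat_inter_le w P₀ T hT hpair hk
  omega

end Seven

end FourCap

end S1

end PercRepro
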